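/-
Copyright (c) 2026. All rights reserved.
Released under Apache 2.0 license as described in the file LICENSE.
-/
import Literature.NumberTheory.ComplexMultiplication.DegenerateCMTypesAbelianSporadicSubsets
import Literature.AlgebraicGeometry.Pohlmann1968.DegenerateCMTypesCyclicCMFieldTwoOddPrimes
import Literature.AlgebraicGeometry.Pohlmann1968.MumfordSimpleFourfoldOfPrimitive
import Literature.AlgebraicGeometry.Pohlmann1968.NondegenerateCMTypeHodgeConjecture
import Literature.AlgebraicGeometry.ComplexMultiplication.CMAbelianVarietyRealisedHolds
import HarnessLib

/-!
# Lenstra's theorem (White 1993, Theorem 3): for an abelian variety `A` of a SIMPLE CM type `(K, S)` with `K/ℚ`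
# ABELIAN, `rank = dim A + 1` iff the Hodge ring of `A` ITSELF is generated by divisor classes

Number-field / abelian-variety dress of the group-level file
`NumberTheory/ComplexMultiplication/DegenerateCMTypesAbelianSporadicSubsets` (White's Lemma 3 and the sporadic
subset).  THEOREMS ONLY (no definition, no named fact, no `sorry`).

## The print

S. P. White, *Sporadic cycles on CM abelian varieties*, Compositio Math. **88** (1993) 123–142
[White1993SporadicCycles] (NUMDAM `CM_1993__88_2_123_0`, held text `paper:url-2830691ae55d`), §1 (p. 123): "Consider the
following two conditions (i) `dim(M_A) = d + 1`, (ii) The ring of Hodge cycles on `A` is generated by classes of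
divisors. … The criterion of Pohlmann immediately shows that (i) implies (ii). Between 1977 and 1978, K. Ribet asked
whether (i) and (ii) were equivalent. H. W. Lenstra, Jr., quickly showed that the conditions were indeed equivalent
under the supplementary hypothesis that `K` is abelian over `ℚ` (see Theorem 3). The purpose of this article is
to construct an explicit example giving a negative answer to the general question"; THEOREM 3 (Lenstra) (p. 131):
"Let `(K, S)` be any simple CM-type, where `K` is a field with abelian Galois group. If `A` is any abelian variety
of CM type `(K, S)` then `rank(M) = dim(A) + 1` if and only if the ring of Hodge cycles on `A` is generated by classes
of images of divisors."  Quoted by F. Hazama, J. Math. Sci. Univ. Tokyo 10 (2003), REMARK 4.10: "It is shown by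
Lenstra that for any abelian variety `A` with complex multiplication by an abelian CM-field, there always exists a
nondivisorial Hodge cycle on `A` itself if `A` is degenerate (see [7])", and by B. B. Gordon, *A survey of the Hodge
conjecture for abelian varieties*, 9.2.2 ([B.138] White).

## Setting

`K` a CM field, normal over `ℚ` with COMMUTATIVE Galois group (`[IsMulCommutative (K ≃ₐ[ℚ] K)]`, the bundled
`CommGroup` instance being Mathlib's scoped one), `Φ` a CM type of `K` (`Motives.CMType`), read on the Galois group
in Shimura's indexing `σ_g = φ₀ ∘ g⁻¹` (`Pohlmann1968.embOf`): `𝓖[φ₀, Φ] = {g | σ_g ∈ Φ}` — LOCAL NOTATION for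
`Finset.univ.filter fun g => embOf φ₀ g ∈ Φ.1`; `Rank(K; Φ) = rank(𝓖[φ₀,Φ])` is the tree's
`cmTypeRank_eq_typeRank_gal` and `𝓖[φ₀, Φ]` is a CM type for the complex conjugation `ρ ∈ Gal(K/ℚ)`
(`isCMTypeWith_gal`).  "Simple CM-type" = PRIMITIVE (`IsPrimitive (ℂ ≃+* ℂ) Φ.1 φh`, Shimura §8.2 Prop. 26; for a
realisation `A` this is `A.IsSimple`, tree `isSimple_iff_isPrimitive`); `rank(M) = dim M_A` is the tree's `cmTypeRank`
(Deligne 1982 Ex. 3.7 / tree `Motives/MumfordTateRankOfCMType`), `dim(A) + 1 = [K:ℚ]/2 + 1` (`IsNondegenerate`);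
"the ring of Hodge cycles on `A` is generated by classes of divisors" = `Bᵐ(A) ⊗ ℂ = Dᵐ(A) ⊗ ℂ` for every `m`
(`VanGeemen1994.hodgeClassSpan = Barriers.HodgeConjecture.divisorClassesSpan`, Pohlmann's Thm. 1 dictionary of
`Pohlmann1968/HodgeClassesCMType`, `DivisorClassesCMType`).

## What is proved

* §1 `exists_sporadic_galType_of_not_isNondegenerate` — a DEGENERATE type of `K` has a SPORADIC subset of
  `Gal(K/ℚ)` (White's `Δ`, balanced for `𝓖[φ₀, Φ]`, `1 ∈ Δ`, `Δ ∩ ρΔ = ∅`): the group-level Lenstra theorem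
  `IsCMTypeWith.exists_sporadic_of_oddCharacter` with Kubota's character.
* §2 **`exists_exceptional_of_not_isNondegenerate`** — for `Φ` PRIMITIVE and DEGENERATE, EVERY abelian variety
  `(A, ι, θ)` of type `(K; Φ)` carries, for some `m`, a rational `(m,m)`-class OUTSIDE `Dᵐ(A) ⊗ ℂ` (Hazama's Rem. 4.10:
  "a nondivisorial Hodge cycle on `A` itself"), through Pohlmann's criterion in White's form
  (`exists_exceptional_iff_of_primitive`: a balanced `2m`-set of embeddings not closed under conjugation);
  `exists_exceptional_of_not_isNondegenerate_of_isSimple` (the same with `A` simple as hypothesis).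
* §3 **THEOREM 3 (Lenstra) as printed**: `isNondegenerate_iff_forall_hodgeClassSpan_eq` —
  `IsNondegenerate Φ ↔ ∀ m, Bᵐ(A) ⊗ ℂ = Dᵐ(A) ⊗ ℂ` for every realisation of a primitive `Φ`
  (⟹ is White's observation via Pohlmann, tree `IsNondegenerate.hodgeClassSpan_eq_divisorClassesSpan`; ⟸ is §2) —
  the all-powers criterion of Hazama (tree `isNondegenerate_iff_forall_pow_hodgeClassSpan_eq`, any CM field)
  improved to `A` ITSELF for abelian `K`; `cmTypeRank_eq_dim_add_one_iff_forall_hodgeClassSpan_eq` (the verbatim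
  "`rank(M) = dim(A) + 1` iff …"), `isNondegenerate_iff_forall_hodgeClassSpan_eq_of_isSimple`.
* §4 `exists_simple_exceptional_of_not_isNondegenerate` — with Shimura's existence theorem (tree
  `exists_isCMTypeRealisation`): a primitive degenerate type of an abelian CM field is carried by a SIMPLE abelian
  variety with a nondivisorial Hodge class.
* §5 (v2 append) **the CODIMENSION of the sporadic class**: `exists_pohlmannSet_of_sporadic_galType_card` and
  **`exists_exceptional_of_sporadic_galType`** — a sporadic `Δ ⊆ Gal(K/ℚ)` (balanced, `1 ∈ Δ`, `Δ ∩ ρΔ = ∅`) with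
  `|Δ| = 2m` gives, on EVERY abelian variety of the (primitive) type, a rational `(m,m)`-class outside `Dᵐ(A) ⊗ ℂ`
  (White p. 124: the "line" `Δ` of `2m` embeddings is a Hodge cycle of codimension `m`); `card_eq_two_mul_of_sporadic`
  (`|Δ|` is even: `|Δ| = 2|Δ ∩ 𝓖[φ₀, Φ]|`).
* §6 (gen 20 append) **the codimension of Lenstra's class for an odd character**: `card_whiteSet_eq_two_mul`,
  **`exists_exceptional_of_oddCharacter`** — for an odd character `χ` of `Gal(K/ℚ)` vanishing on `𝓖[φ₀, Φ]`
  (`Φ` primitive), every `A` of type `(K; Φ)` carries a rational `(m,m)`-class outside `Dᵐ(A) ⊗ ℂ` with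
  `m = 2^{ω(N)−1}·|ker χ|/2`, `N = [Gal : ker χ]` (group level: `WhiteLenstra.card_whiteSet_card`);
  `exists_exceptional_of_faithful_oddCharacter` (`χ` faithful, `ω([K:ℚ]) ≥ 2`: `m = 2^{ω([K:ℚ])−2}` — `2` for
  `[K:ℚ] = 2pq`, `4` for Lenstra's `2pqr`).

White's Theorem 1 (for `K` NON-abelian the equivalence fails: a degenerate simple type all of whose sporadic cycles
live on proper powers) is NOT formalised.

## References

* [White1993SporadicCycles] S. P. White, Compositio Math. 88 (1993) 123–142, §1, Lemma 3, Theorem 3.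
* [Hazama2003CyclicCM] F. Hazama, J. Math. Sci. Univ. Tokyo 10 (2003), Rem. 4.10.
* [Gordon1999HodgeAVSurvey] B. B. Gordon, *A survey of the Hodge conjecture for abelian varieties*, 9.2.2, §9.3,
  Thm. 6.4.
* [Pohlmann1968] H. Pohlmann, Ann. of Math. 88 (1968), Thm. 1 and §3.
* [Kubota1965] T. Kubota, Trans. AMS 118 (1965), §4 Lemma 2.
* [Shimura1998] G. Shimura, *Abelian Varieties with Complex Multiplication and Modular Functions*, §8.2 Prop. 26,
  §6.2 Thm. 3, §18.2.

## Provenance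

Cell `pub-hodgecm2` (COR-CM), literature seat `lit-deligne-3` gen 19 (claim WHITE-LENSTRA; count-neutral).
-/

set_option autoImplicit false

noncomputable section

open scoped BigOperators NumberField IsMulCommutative Classical
open CategoryTheory NumberField

namespace Literature.AlgebraicGeometry.Pohlmann1968

namespace AbelianCMField

open Literature.NumberTheory.ComplexMultiplication
open Literature.AlgebraicGeometry.Motives (AbelianVariety CMType)
open Literature.AlgebraicGeometry.HodgeTheory
open Literature.AlgebraicGeometry.VanGeemen1994 (hodgeClassSpan)
open Literature.AlgebraicGeometry.ComplexMultiplication (IsCMTypeRealisation isSimple_iff_isPrimitive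
  exists_isCMTypeRealisation)
open Literature.Barriers.HodgeConjecture (divisorClassesSpan)
open CyclicTwoOddPrimes (gal_comm coe_galType mem_galType_iff isCMTypeWith_galType cmTypeRank_eq_typeRank_galType)

/-- `𝓖[φ₀, Φ] = {g ∈ Gal(K/ℚ) : σ_g = φ₀ ∘ g⁻¹ ∈ Φ}` — the CM type read on the Galois group (local notation, as in
`DegenerateCMTypesCyclicCMFieldTwoOddPrimes`, whose bookkeeping lemmas `coe_galType`, `mem_galType_iff`,
`isCMTypeWith_galType`, `cmTypeRank_eq_typeRank_galType` are reused). -/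
local notation3 "𝓖[" φ₀ ", " Φ "]" =>
  Finset.filter (fun g => embOf φ₀ g ∈ (Φ : CMType _).1) Finset.univ

variable {K : Type} [Field K] [NumberField K] [Normal ℚ K] [IsMulCommutative (K ≃ₐ[ℚ] K)]
variable {ρ : K ≃ₐ[ℚ] K} {φ₀ : K →+* ℂ}

/-! ## §1 The sporadic subset of the Galois group -/

section Galois

omit [IsMulCommutative (K ≃ₐ[ℚ] K)] in
/-- `[K : ℚ]/2 = |Gal(K/ℚ)|/2`. [cite: Shimura1998, §8.1] -/
theorem finrank_div_two_eq_card_div_two [IsCMField K] (φ₀ : K →+* ℂ) :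
    Module.finrank ℚ K / 2 = Fintype.card (K ≃ₐ[ℚ] K) / 2 := by
  rw [card_gal_eq_finrank φ₀]

/-- **Degenerate ⟺ not of maximal group-level rank.** [cite: White1993SporadicCycles, §3 (p. 129) and §4 Lemma 2] -/
theorem not_isNondegenerate_iff_typeRank_ne [IsCMField K] (Φ : CMType K) (φ₀ : K →+* ℂ) :
    ¬ IsNondegenerate Φ ↔
      typeRank (K ≃ₐ[ℚ] K) (↑𝓖[φ₀, Φ] : Set (K ≃ₐ[ℚ] K)) ≠ Fintype.card (K ≃ₐ[ℚ] K) / 2 + 1 := by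
  rw [_root_.Literature.AlgebraicGeometry.Pohlmann1968.isNondegenerate_iff, cmTypeRank_eq_typeRank_galType Φ φ₀,
    finrank_div_two_eq_card_div_two φ₀]

/-- **LENSTRA'S THEOREM ON THE GALOIS GROUP: a degenerate CM type of an abelian CM field has a SPORADIC subset.**
If `Φ` is DEGENERATE (`Rank(K; Φ) ≠ [K:ℚ]/2 + 1`) there is `Δ ⊆ Gal(K/ℚ)` with `𝟙_Δ` satisfying Pohlmann's condition
for `𝓖[φ₀, Φ]` (`|gΔ ∩ 𝓖| = |gΔ ∩ ρ𝓖|` for all `g`), `1 ∈ Δ` and `Δ ∩ ρΔ = ∅` — White's `Δ` for an odd character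
vanishing on `𝓖[φ₀, Φ]` (Kubota). [cite: White1993SporadicCycles, §4 Lemma 3 and Theorem 3] [cite: Kubota1965, §4 Lemma 2] -/
theorem exists_sporadic_galType_of_not_isNondegenerate [IsCMField K]
    (hρ : ∀ x, φ₀ (ρ x) = starRingEnd ℂ (φ₀ x)) (Φ : CMType K) (hdeg : ¬ IsNondegenerate Φ) :
    ∃ Δ : Finset (K ≃ₐ[ℚ] K),
      IsBalanced (K ≃ₐ[ℚ] K) (↑𝓖[φ₀, Φ] : Set (K ≃ₐ[ℚ] K)) (fun g => if g ∈ Δ then (1 : ℚ) else 0) ∧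
        (1 : K ≃ₐ[ℚ] K) ∈ Δ ∧ ∀ g ∈ Δ, ρ * g ∉ Δ := by
  have h := isCMTypeWith_galType hρ Φ
  have hne := (not_isNondegenerate_iff_typeRank_ne Φ φ₀).1 hdeg
  rw [ne_eq, h.typeRank_eq_iff_forall_oddCharacters] at hne
  push Not at hne
  obtain ⟨χ, hodd, hvan⟩ := hne
  exact h.exists_sporadic_of_oddCharacter χ hodd hvan

/-- **Conversely (any CM field): a sporadic subset of the Galois group forces degeneracy** (White §4 with Lemma 2;
tree `symm_of_isBalanced_of_typeRank_eq`). [cite: White1993SporadicCycles, §4 Lemma 2 and Theorem 3] -/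
theorem not_isNondegenerate_of_sporadic_galType [IsCMField K] (hρ : ∀ x, φ₀ (ρ x) = starRingEnd ℂ (φ₀ x))
    (Φ : CMType K) {Δ : Finset (K ≃ₐ[ℚ] K)}
    (hbal : IsBalanced (K ≃ₐ[ℚ] K) (↑𝓖[φ₀, Φ] : Set (K ≃ₐ[ℚ] K)) (fun g => if g ∈ Δ then (1 : ℚ) else 0))
    {g₀ : K ≃ₐ[ℚ] K} (hg₀ : g₀ ∈ Δ) (hg₀' : ρ * g₀ ∉ Δ) : ¬ IsNondegenerate Φ :=
  (not_isNondegenerate_iff_typeRank_ne Φ φ₀).2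
    ((isCMTypeWith_galType hρ Φ).typeRank_ne_iff_exists_sporadic.2 ⟨Δ, hbal, g₀, hg₀, hg₀'⟩)

/-- **Degenerate ⟺ a sporadic subset of `Gal(K/ℚ)` exists**, for an abelian CM field.
[cite: White1993SporadicCycles, §4 Theorem 3] -/
theorem not_isNondegenerate_iff_exists_sporadic_galType [IsCMField K]
    (hρ : ∀ x, φ₀ (ρ x) = starRingEnd ℂ (φ₀ x)) (Φ : CMType K) :
    ¬ IsNondegenerate Φ ↔ ∃ Δ : Finset (K ≃ₐ[ℚ] K),
      IsBalanced (K ≃ₐ[ℚ] K) (↑𝓖[φ₀, Φ] : Set (K ≃ₐ[ℚ] K)) (fun g => if g ∈ Δ then (1 : ℚ) else 0) ∧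
        ∃ g ∈ Δ, ρ * g ∉ Δ := by
  rw [not_isNondegenerate_iff_typeRank_ne Φ φ₀]
  exact (isCMTypeWith_galType hρ Φ).typeRank_ne_iff_exists_sporadic

end Galois

/-! ## §2 The sporadic cycle on `A` itself -/

section AbelianVarieties

variable {Φ : CMType K}
variable {A : AbelianVariety ℂ} {ι : 𝓞 K →+* End A} {θ : K →+* Module.End ℂ (complexBetti A.X 1)}

omit [Normal ℚ K] [IsMulCommutative (K ≃ₐ[ℚ] K)] in
/-- The separation hypothesis of the tree's `exists_exceptional_iff_of_primitive` from `IsPrimitive`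
("simple CM-type", Shimura §8.2 Prop. 26). [cite: Shimura1998, §8.2 Prop. 26] -/
theorem separating_of_isPrimitive [IsCMField K] (Φ : CMType K) {φh : K →+* ℂ}
    (hprim : IsPrimitive (ℂ ≃+* ℂ) Φ.1 φh) :
    ∀ s t : K →+* ℂ, (∀ γ : ℂ ≃+* ℂ, ((γ : ℂ →+* ℂ).comp s ∈ Φ.1 ↔ (γ : ℂ →+* ℂ).comp t ∈ Φ.1)) → s = t := by
  haveI := isPretransitive_ringEquiv_complex (K := K)
  have hP := (isPrimitive_iff_forall_eq Φ.1 φh).1 hprim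
  intro s t hst
  exact hP s t fun γ => by simpa [ringEquiv_smul_def] using hst γ

omit [Normal ℚ K] [IsMulCommutative (K ≃ₐ[ℚ] K)] in
/-- Pohlmann's condition for the indicator of `Δ ⊆ Gal(K/ℚ)`: `2·#{d ∈ Δ : gd ∈ 𝓖} = #Δ` for every `g` (the tree's
`CyclicCMType.isBalanced_indicator_iff`, re-proved here to keep the imports light). [cite: Gordon1999HodgeAVSurvey, §9.2 (9.2.1)] -/
private theorem two_mul_card_filter_eq_of_isBalanced (Ψ Δ : Finset (K ≃ₐ[ℚ] K))
    (hbal : IsBalanced (K ≃ₐ[ℚ] K) (Ψ : Set (K ≃ₐ[ℚ] K)) (fun d => if d ∈ Δ then (1 : ℚ) else 0))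
    (g : K ≃ₐ[ℚ] K) : 2 * (Δ.filter fun d => g * d ∈ Ψ).card = Δ.card := by
  have h1 : ∑ x : K ≃ₐ[ℚ] K, (if x ∈ Δ then (1 : ℚ) else 0) * translateInd (Ψ : Set (K ≃ₐ[ℚ] K)) g x =
      ((Δ.filter fun d => g * d ∈ Ψ).card : ℚ) := by
    rw [Finset.card_filter, Nat.cast_sum, ← Finset.sum_filter_add_sum_filter_not Finset.univ (· ∈ Δ),
      Finset.filter_mem_eq_inter, Finset.univ_inter]
    have hzero : ∑ x ∈ Finset.univ.filter (fun x => x ∉ Δ),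
        (if x ∈ Δ then (1 : ℚ) else 0) * translateInd (Ψ : Set (K ≃ₐ[ℚ] K)) g x = 0 :=
      Finset.sum_eq_zero fun x hx => by rw [if_neg (Finset.mem_filter.1 hx).2, zero_mul]
    rw [hzero, add_zero]
    refine Finset.sum_congr rfl fun x hx => ?_
    rw [if_pos hx, one_mul]
    unfold translateInd
    simp only [smul_eq_mul, Finset.mem_coe]
    split_ifs <;> simp
  have h2 : ∑ x : K ≃ₐ[ℚ] K, (if x ∈ Δ then (1 : ℚ) else 0) = (Δ.card : ℚ) := by
    rw [Finset.sum_boole, Finset.filter_mem_eq_inter, Finset.univ_inter]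
  have h := hbal g
  rw [h1, h2] at h
  exact_mod_cast h

/-- **From a sporadic subset of `Gal(K/ℚ)` to a sporadic set of EMBEDDINGS**: `Δ ↦ {σ_g : g ∈ Δ}` carries a
balanced `Δ ∋ 1` with `Δ ∩ ρΔ = ∅` to a Galois-balanced `2m`-set of embeddings containing `σ_1 = φ₀` but not
`σ̄_1` (`m = |Δ ∩ 𝓖|`; `γ ∘ σ_g = σ_{δ⁻¹g}` for `γ ∘ φ₀ = φ₀ ∘ δ`). [cite: White1993SporadicCycles, §1 (p. 124) and §4]
[cite: Gordon1999HodgeAVSurvey, 9.2.2] -/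
theorem exists_pohlmannSet_of_sporadic_galType [IsCMField K] (hρ : ∀ x, φ₀ (ρ x) = starRingEnd ℂ (φ₀ x))
    (Φ : CMType K) {ΔG : Finset (K ≃ₐ[ℚ] K)}
    (hbal : IsBalanced (K ≃ₐ[ℚ] K) (↑𝓖[φ₀, Φ] : Set (K ≃ₐ[ℚ] K)) (fun g => if g ∈ ΔG then (1 : ℚ) else 0))
    (h1 : (1 : K ≃ₐ[ℚ] K) ∈ ΔG) (hsp : ∀ g ∈ ΔG, ρ * g ∉ ΔG) :
    ∃ m : ℕ, ∃ Δ ∈ pohlmannSets Φ m, φ₀ ∈ Δ ∧ ComplexEmbedding.conjugate φ₀ ∉ Δ := by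
  have hinj := (embOf_bijective φ₀).1
  set Δ : Finset (K →+* ℂ) := ΔG.image (embOf φ₀) with hΔ
  set m : ℕ := (ΔG.filter fun d => (1 : K ≃ₐ[ℚ] K) * d ∈ 𝓖[φ₀, Φ]).card with hm
  have hbalG := two_mul_card_filter_eq_of_isBalanced 𝓖[φ₀, Φ] ΔG hbal
  have hcardG : ΔG.card = 2 * m := (hbalG 1).symm
  have hcard : Δ.card = 2 * m := by rw [hΔ, Finset.card_image_of_injective _ hinj, hcardG]
  -- Galois-balanced
  have hbalΔ : IsGaloisBalanced Φ Δ := by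
    rw [isGaloisBalanced_iff_two_mul]
    intro γ
    obtain ⟨δ, hδ⟩ := exists_algEquiv_comp_eq_smul φ₀ γ
    have hset : {s : K →+* ℂ | s ∈ Δ ∧ (γ : ℂ →+* ℂ).comp s ∈ Φ.1} =
        ↑((ΔG.filter fun d => δ⁻¹ * d ∈ 𝓖[φ₀, Φ]).image (embOf φ₀)) := by
      ext s
      simp only [Set.mem_setOf_eq, Finset.coe_image, Finset.coe_filter, Set.mem_image, hΔ, Finset.mem_image]
      constructor
      · rintro ⟨⟨d, hd, rfl⟩, hs⟩
        refine ⟨d, ⟨hd, ?_⟩, rfl⟩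
        rw [mem_galType_iff, mul_comm, ← smul_embOf_of_comp φ₀ hδ, ringEquiv_smul_def]
        exact hs
      · rintro ⟨d, ⟨hd, hd'⟩, rfl⟩
        refine ⟨⟨d, hd, rfl⟩, ?_⟩
        rw [mem_galType_iff, mul_comm, ← smul_embOf_of_comp φ₀ hδ, ringEquiv_smul_def] at hd'
        exact hd'
    rw [hset, Set.ncard_coe_finset, Finset.card_image_of_injective _ hinj, hcard, ← hcardG]
    exact hbalG δ⁻¹
  -- `σ_1 = φ₀ ∈ Δ`, `σ̄_1 = σ_ρ ∉ Δ`
  have hφ₀ : embOf φ₀ 1 = φ₀ := by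
    refine RingHom.ext fun x => ?_
    rw [embOf_apply]
    rfl
  refine ⟨m, Δ, ⟨hcard, hbalΔ⟩, ?_, ?_⟩
  · rw [← hφ₀]
    exact Finset.mem_image_of_mem _ h1
  · rw [← hφ₀, conjugate_embOf gal_comm hρ, hΔ, Finset.mem_image]
    rintro ⟨d, hd, he⟩
    rw [hinj he] at hd
    exact hsp 1 h1 hd

/-- **REMARK 4.10 (Lenstra) / THEOREM 3, the degenerate direction, for EVERY abelian CM field**: if `K/ℚ` is
abelian, `Φ` is PRIMITIVE ("simple CM-type") and DEGENERATE, then every abelian variety `A` of type `(K; Φ)` carries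
a NONDIVISORIAL HODGE CYCLE ON `A` ITSELF — for some `m`, a rational `(m,m)`-class outside `Dᵐ(A) ⊗ ℂ` ("there
exists an element in `N` whose coefficients are `0, ±1` … which gives us a line `Δ` containing a sporadic cycle on
`A`").  Compare the tree's `exists_exceptional_pow_of_not_isNondegenerate` (any CM field: a sporadic cycle on
SOME POWER `Aⁿ`). [cite: White1993SporadicCycles, §4 Theorem 3] [cite: Hazama2003CyclicCM, Rem. 4.10]
[cite: Gordon1999HodgeAVSurvey, 9.2.2] [cite: Pohlmann1968, Thm. 1 and §3] -/
theorem exists_exceptional_of_not_isNondegenerate [IsCMField K] {φh : K →+* ℂ}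
    (hprim : IsPrimitive (ℂ ≃+* ℂ) Φ.1 φh) (hdeg : ¬ IsNondegenerate Φ) (hA : IsCMTypeRealisation Φ A ι θ) :
    ∃ m : ℕ, ∃ c : complexBetti A.X (2 * m), IsRationalClass c ∧
      IsOfHodgeType (Module.finrank ℚ K / 2) A.X (2 * m) m m c ∧
      c ∉ divisorClassesSpan A.X (Module.finrank ℚ K / 2) m := by
  -- the complex conjugation of `K` read in `Gal(K/ℚ)`, and a base embedding
  obtain ⟨φ₀⟩ : Nonempty (K →+* ℂ) := inferInstance
  set ρ : K ≃ₐ[ℚ] K := (IsCMField.complexConj K).restrictScalars ℚ with hρdef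
  have hρ : ∀ x, φ₀ (ρ x) = starRingEnd ℂ (φ₀ x) := fun x => by
    rw [hρdef, AlgEquiv.restrictScalars_apply]
    exact IsCMField.complexEmbedding_complexConj K φ₀ x
  obtain ⟨ΔG, hbal, h1, hsp⟩ := exists_sporadic_galType_of_not_isNondegenerate hρ Φ hdeg
  obtain ⟨m, Δ, hΔ, hφ₀, hφ₀'⟩ := exists_pohlmannSet_of_sporadic_galType hρ Φ hbal h1 hsp
  exact ⟨m, (exists_exceptional_iff_of_primitive hA (separating_of_isPrimitive Φ hprim) m).2
    ⟨Δ, hΔ, φ₀, hφ₀, hφ₀'⟩⟩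

/-- The same with `A` SIMPLE as the hypothesis (Shimura §8.2 Prop. 26: `A` simple ⟺ `Φ` primitive, tree
`isSimple_iff_isPrimitive`). [cite: White1993SporadicCycles, §4 Theorem 3] [cite: Shimura1998, §8.2 Prop. 26] -/
theorem exists_exceptional_of_not_isNondegenerate_of_isSimple [IsCMField K] (hA : IsCMTypeRealisation Φ A ι θ)
    (hS : A.IsSimple) (hdeg : ¬ IsNondegenerate Φ) :
    ∃ m : ℕ, ∃ c : complexBetti A.X (2 * m), IsRationalClass c ∧
      IsOfHodgeType (Module.finrank ℚ K / 2) A.X (2 * m) m m c ∧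
      c ∉ divisorClassesSpan A.X (Module.finrank ℚ K / 2) m := by
  obtain ⟨φh⟩ : Nonempty (K →+* ℂ) := inferInstance
  exact exists_exceptional_of_not_isNondegenerate ((isSimple_iff_isPrimitive hA φh).1 hS) hdeg hA

/-! ## §3 THEOREM 3 (Lenstra) as printed -/

/-- **THEOREM 3 (Lenstra).**  "Let `(K, S)` be any simple CM-type, where `K` is a field with abelian Galois group. If
`A` is any abelian variety of CM type `(K, S)` then `rank(M) = dim(A) + 1` if and only if the ring of Hodge cycles on
`A` is generated by classes of images of divisors": for `K/ℚ` abelian, `Φ` primitive and ANY realisation `(A, ι, θ)`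
of `(K; Φ)`, `IsNondegenerate Φ ↔ ∀ m, Bᵐ(A) ⊗ ℂ = Dᵐ(A) ⊗ ℂ`.  (⟹, "the criterion of Pohlmann immediately shows
that (i) implies (ii)", is the tree's `IsNondegenerate.hodgeClassSpan_eq_divisorClassesSpan` and holds for every CM
field; ⟸ is Lenstra's.) [cite: White1993SporadicCycles, §4 Theorem 3] [cite: Gordon1999HodgeAVSurvey, §9.3 and 9.2.2] -/
theorem isNondegenerate_iff_forall_hodgeClassSpan_eq [IsCMField K] {φh : K →+* ℂ}
    (hprim : IsPrimitive (ℂ ≃+* ℂ) Φ.1 φh) (hA : IsCMTypeRealisation Φ A ι θ) :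
    IsNondegenerate Φ ↔ ∀ m : ℕ,
      hodgeClassSpan (Module.finrank ℚ K / 2) A.X m = divisorClassesSpan A.X (Module.finrank ℚ K / 2) m := by
  refine ⟨fun hΦ m => hΦ.hodgeClassSpan_eq_divisorClassesSpan hA m, fun h => ?_⟩
  by_contra hdeg
  obtain ⟨m, c, hcQ, hcH, hcD⟩ := exists_exceptional_of_not_isNondegenerate hprim hdeg hA
  exact hcD ((h m) ▸ Submodule.subset_span ⟨hcQ, hcH⟩)

/-- **THEOREM 3 verbatim: "`rank(M) = dim(A) + 1` if and only if …".** [cite: White1993SporadicCycles, §4 Theorem 3] -/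
theorem cmTypeRank_eq_dim_add_one_iff_forall_hodgeClassSpan_eq [IsCMField K] {φh : K →+* ℂ}
    (hprim : IsPrimitive (ℂ ≃+* ℂ) Φ.1 φh) (hA : IsCMTypeRealisation Φ A ι θ) :
    cmTypeRank Φ = A.dim + 1 ↔ ∀ m : ℕ,
      hodgeClassSpan (Module.finrank ℚ K / 2) A.X m = divisorClassesSpan A.X (Module.finrank ℚ K / 2) m := by
  have hd : A.dim = Module.finrank ℚ K / 2 := Motives.schemeDim_eq_holds hA.1
  rw [hd, ← _root_.Literature.AlgebraicGeometry.Pohlmann1968.isNondegenerate_iff]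
  exact isNondegenerate_iff_forall_hodgeClassSpan_eq hprim hA

/-- **THEOREM 3 for a SIMPLE `A` with complex multiplication by an abelian CM field** (hypothesis on `A` rather than
on the type). [cite: White1993SporadicCycles, §4 Theorem 3] [cite: Shimura1998, §8.2 Prop. 26] -/
theorem isNondegenerate_iff_forall_hodgeClassSpan_eq_of_isSimple [IsCMField K] (hA : IsCMTypeRealisation Φ A ι θ)
    (hS : A.IsSimple) :
    IsNondegenerate Φ ↔ ∀ m : ℕ,
      hodgeClassSpan (Module.finrank ℚ K / 2) A.X m = divisorClassesSpan A.X (Module.finrank ℚ K / 2) m := by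
  obtain ⟨φh⟩ : Nonempty (K →+* ℂ) := inferInstance
  exact isNondegenerate_iff_forall_hodgeClassSpan_eq ((isSimple_iff_isPrimitive hA φh).1 hS) hA

/-- **The two conditions of White's §1 for a simple CM abelian variety over an abelian CM field**: (i) `Rank = dim A
+ 1` FAILS iff (ii) FAILS, i.e. `A` is degenerate iff `A` ITSELF carries a rational Hodge class outside the divisor
ring. [cite: White1993SporadicCycles, §1 (i)–(ii) and §4 Theorem 3] -/
theorem not_isNondegenerate_iff_exists_exceptional [IsCMField K] {φh : K →+* ℂ}
    (hprim : IsPrimitive (ℂ ≃+* ℂ) Φ.1 φh) (hA : IsCMTypeRealisation Φ A ι θ) :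
    ¬ IsNondegenerate Φ ↔ ∃ m : ℕ, ∃ c : complexBetti A.X (2 * m), IsRationalClass c ∧
      IsOfHodgeType (Module.finrank ℚ K / 2) A.X (2 * m) m m c ∧
      c ∉ divisorClassesSpan A.X (Module.finrank ℚ K / 2) m := by
  refine ⟨fun hdeg => exists_exceptional_of_not_isNondegenerate hprim hdeg hA, ?_⟩
  rintro ⟨m, hm⟩ hΦ
  exact hΦ.not_exists_exceptional hA m hm

end AbelianVarieties

/-! ## §4 Simple degenerate CM abelian varieties with a sporadic cycle exist over every abelian CM field carrying
a primitive degenerate type -/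

section Existence

/-- **Existence**: a PRIMITIVE DEGENERATE CM type `Φ` of an abelian CM field `K` is carried (Shimura §6.2 Thm. 3,
tree `exists_isCMTypeRealisation`) by a SIMPLE abelian variety `A` of dimension `[K:ℚ]/2` with a rational
`(m,m)`-class outside `Dᵐ(A) ⊗ ℂ` for some `m`. [cite: White1993SporadicCycles, §4 Theorem 3]
[cite: Shimura1998, §6.2 Theorem 3 and §8.2 Prop. 26] -/
theorem exists_simple_exceptional_of_not_isNondegenerate [IsCMField K] (Φ : CMType K) {φh : K →+* ℂ}
    (hprim : IsPrimitive (ℂ ≃+* ℂ) Φ.1 φh) (hdeg : ¬ IsNondegenerate Φ) :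
    ∃ (A : AbelianVariety ℂ) (ι : 𝓞 K →+* End A) (θ : K →+* Module.End ℂ (complexBetti A.X 1)),
      IsCMTypeRealisation Φ A ι θ ∧ A.IsSimple ∧ A.dim = Module.finrank ℚ K / 2 ∧
        ∃ m : ℕ, ∃ c : complexBetti A.X (2 * m), IsRationalClass c ∧
          IsOfHodgeType (Module.finrank ℚ K / 2) A.X (2 * m) m m c ∧
          c ∉ divisorClassesSpan A.X (Module.finrank ℚ K / 2) m := by
  obtain ⟨A, ι, θ, hA⟩ := exists_isCMTypeRealisation Φ
  exact ⟨A, ι, θ, hA, (isSimple_iff_isPrimitive hA φh).2 hprim, Motives.schemeDim_eq_holds hA.1,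
    exists_exceptional_of_not_isNondegenerate hprim hdeg hA⟩

end Existence

/-! ## §5 The codimension of the sporadic class: `m = |Δ|/2` (v2 append) -/

section Codimension

variable {Φ : CMType K}
variable {A : AbelianVariety ℂ} {ι : 𝓞 K →+* End A} {θ : K →+* Module.End ℂ (complexBetti A.X 1)}

omit [Normal ℚ K] in
/-- **A sporadic subset has even cardinality `|Δ| = 2|Δ ∩ 𝓖[φ₀, Φ]|`** (balancedness at `g = 1`).
[cite: White1993SporadicCycles, §1 (p. 124: "a subset `Δ` of `2m` embeddings")] -/
theorem card_eq_two_mul_of_sporadic (Φ : CMType K) {ΔG : Finset (K ≃ₐ[ℚ] K)}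
    (hbal : IsBalanced (K ≃ₐ[ℚ] K) (↑𝓖[φ₀, Φ] : Set (K ≃ₐ[ℚ] K)) (fun g => if g ∈ ΔG then (1 : ℚ) else 0)) :
    ΔG.card = 2 * (ΔG.filter fun d => d ∈ 𝓖[φ₀, Φ]).card := by
  have h := two_mul_card_filter_eq_of_isBalanced 𝓖[φ₀, Φ] ΔG hbal 1
  simp only [one_mul] at h
  exact h.symm

/-- **From a sporadic subset of `Gal(K/ℚ)` of cardinality `2m` to a sporadic `2m`-set of EMBEDDINGS** — the
codimension-explicit form of `exists_pohlmannSet_of_sporadic_galType` (`Δ ↦ {σ_g : g ∈ Δ}`, same cardinality).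
[cite: White1993SporadicCycles, §1 (p. 124) and §4 Theorem 3 (proof)] [cite: Gordon1999HodgeAVSurvey, 9.2.2] -/
theorem exists_pohlmannSet_of_sporadic_galType_card [IsCMField K] (hρ : ∀ x, φ₀ (ρ x) = starRingEnd ℂ (φ₀ x))
    (Φ : CMType K) {ΔG : Finset (K ≃ₐ[ℚ] K)}
    (hbal : IsBalanced (K ≃ₐ[ℚ] K) (↑𝓖[φ₀, Φ] : Set (K ≃ₐ[ℚ] K)) (fun g => if g ∈ ΔG then (1 : ℚ) else 0))
    (h1 : (1 : K ≃ₐ[ℚ] K) ∈ ΔG) (hsp : ∀ g ∈ ΔG, ρ * g ∉ ΔG) {m : ℕ} (hm : ΔG.card = 2 * m) :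
    ∃ Δ ∈ pohlmannSets Φ m, φ₀ ∈ Δ ∧ ComplexEmbedding.conjugate φ₀ ∉ Δ := by
  have hinj := (embOf_bijective φ₀).1
  set Δ : Finset (K →+* ℂ) := ΔG.image (embOf φ₀) with hΔ
  have hbalG := two_mul_card_filter_eq_of_isBalanced 𝓖[φ₀, Φ] ΔG hbal
  have hcard : Δ.card = 2 * m := by rw [hΔ, Finset.card_image_of_injective _ hinj, hm]
  -- Galois-balanced
  have hbalΔ : IsGaloisBalanced Φ Δ := by
    rw [isGaloisBalanced_iff_two_mul]
    intro γ
    obtain ⟨δ, hδ⟩ := exists_algEquiv_comp_eq_smul φ₀ γ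
    have hset : {s : K →+* ℂ | s ∈ Δ ∧ (γ : ℂ →+* ℂ).comp s ∈ Φ.1} =
        ↑((ΔG.filter fun d => δ⁻¹ * d ∈ 𝓖[φ₀, Φ]).image (embOf φ₀)) := by
      ext s
      simp only [Set.mem_setOf_eq, Finset.coe_image, Finset.coe_filter, Set.mem_image, hΔ, Finset.mem_image]
      constructor
      · rintro ⟨⟨d, hd, rfl⟩, hs⟩
        refine ⟨d, ⟨hd, ?_⟩, rfl⟩
        rw [mem_galType_iff, mul_comm, ← smul_embOf_of_comp φ₀ hδ, ringEquiv_smul_def]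
        exact hs
      · rintro ⟨d, ⟨hd, hd'⟩, rfl⟩
        refine ⟨⟨d, hd, rfl⟩, ?_⟩
        rw [mem_galType_iff, mul_comm, ← smul_embOf_of_comp φ₀ hδ, ringEquiv_smul_def] at hd'
        exact hd'
    rw [hset, Set.ncard_coe_finset, Finset.card_image_of_injective _ hinj, hcard, ← hm]
    exact hbalG δ⁻¹
  -- `σ_1 = φ₀ ∈ Δ`, `σ̄_1 = σ_ρ ∉ Δ`
  have hφ₀ : embOf φ₀ 1 = φ₀ := by
    refine RingHom.ext fun x => ?_
    rw [embOf_apply]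
    rfl
  refine ⟨Δ, ⟨hcard, hbalΔ⟩, ?_, ?_⟩
  · rw [← hφ₀]
    exact Finset.mem_image_of_mem _ h1
  · rw [← hφ₀, conjugate_embOf gal_comm hρ, hΔ, Finset.mem_image]
    rintro ⟨d, hd, he⟩
    rw [hinj he] at hd
    exact hsp 1 h1 hd

/-- **THE SPORADIC CYCLE OF A SPORADIC `Δ` HAS CODIMENSION `|Δ|/2`**: for `Φ` PRIMITIVE and a sporadic subset
`Δ ⊆ Gal(K/ℚ)` (balanced for `𝓖[φ₀, Φ]`, `1 ∈ Δ`, `Δ ∩ ρΔ = ∅`, `ρ` the complex conjugation at `φ₀`) with `|Δ| = 2m`,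
EVERY abelian variety of type `(K; Φ)` carries a rational `(m,m)`-class outside `Dᵐ(A) ⊗ ℂ` (White: the "line"
`Δ` "gives us … a sporadic cycle on `A`", of codimension `m`).
[cite: White1993SporadicCycles, §1 (p. 124) and §4 Theorem 3 (proof)] [cite: Pohlmann1968, Thm. 1 and §3]
[cite: Gordon1999HodgeAVSurvey, 9.2.2] -/
theorem exists_exceptional_of_sporadic_galType [IsCMField K] (hρ : ∀ x, φ₀ (ρ x) = starRingEnd ℂ (φ₀ x))
    {φh : K →+* ℂ} (hprim : IsPrimitive (ℂ ≃+* ℂ) Φ.1 φh) {ΔG : Finset (K ≃ₐ[ℚ] K)}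
    (hbal : IsBalanced (K ≃ₐ[ℚ] K) (↑𝓖[φ₀, Φ] : Set (K ≃ₐ[ℚ] K)) (fun g => if g ∈ ΔG then (1 : ℚ) else 0))
    (h1 : (1 : K ≃ₐ[ℚ] K) ∈ ΔG) (hsp : ∀ g ∈ ΔG, ρ * g ∉ ΔG) {m : ℕ} (hm : ΔG.card = 2 * m)
    (hA : IsCMTypeRealisation Φ A ι θ) :
    ∃ c : complexBetti A.X (2 * m), IsRationalClass c ∧
      IsOfHodgeType (Module.finrank ℚ K / 2) A.X (2 * m) m m c ∧
      c ∉ divisorClassesSpan A.X (Module.finrank ℚ K / 2) m := by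
  obtain ⟨Δ, hΔ, hφ₀, hφ₀'⟩ := exists_pohlmannSet_of_sporadic_galType_card hρ Φ hbal h1 hsp hm
  exact (exists_exceptional_iff_of_primitive hA (separating_of_isPrimitive Φ hprim) m).2 ⟨Δ, hΔ, φ₀, hφ₀, hφ₀'⟩

/-- The same with the codimension read off as `|Δ ∩ 𝓖[φ₀, Φ]|`. [cite: White1993SporadicCycles, §4 Theorem 3 (proof)] -/
theorem exists_exceptional_of_sporadic_galType' [IsCMField K] (hρ : ∀ x, φ₀ (ρ x) = starRingEnd ℂ (φ₀ x))
    {φh : K →+* ℂ} (hprim : IsPrimitive (ℂ ≃+* ℂ) Φ.1 φh) {ΔG : Finset (K ≃ₐ[ℚ] K)}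
    (hbal : IsBalanced (K ≃ₐ[ℚ] K) (↑𝓖[φ₀, Φ] : Set (K ≃ₐ[ℚ] K)) (fun g => if g ∈ ΔG then (1 : ℚ) else 0))
    (h1 : (1 : K ≃ₐ[ℚ] K) ∈ ΔG) (hsp : ∀ g ∈ ΔG, ρ * g ∉ ΔG) (hA : IsCMTypeRealisation Φ A ι θ) :
    ∃ c : complexBetti A.X (2 * (ΔG.filter fun d => d ∈ 𝓖[φ₀, Φ]).card), IsRationalClass c ∧
      IsOfHodgeType (Module.finrank ℚ K / 2) A.X (2 * (ΔG.filter fun d => d ∈ 𝓖[φ₀, Φ]).card)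
        (ΔG.filter fun d => d ∈ 𝓖[φ₀, Φ]).card (ΔG.filter fun d => d ∈ 𝓖[φ₀, Φ]).card c ∧
      c ∉ divisorClassesSpan A.X (Module.finrank ℚ K / 2) (ΔG.filter fun d => d ∈ 𝓖[φ₀, Φ]).card :=
  exists_exceptional_of_sporadic_galType hρ hprim hbal h1 hsp (card_eq_two_mul_of_sporadic Φ hbal) hA

end Codimension

/-! ## §6 The codimension of Lenstra's class for an odd character (gen 20 append)

For an ODD character `χ` of `Gal(K/ℚ)` VANISHING on `𝓖[φ₀, Φ]` (Kubota's witness of degeneracy), White's set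
`Δ = whiteSet |G| χ` is sporadic (`IsCMTypeWith.exists_sporadic_of_oddCharacter`) and has
`|Δ| = 2^{ω(N)−1}·|ker χ|`, `N = |χ(G)| = [G : ker χ]` (`WhiteLenstra.card_whiteSet_card`); so on every abelian variety
of the (primitive) type the sporadic class it indexes has codimension `m = |Δ|/2 = 2^{ω(N)−1}·|ker χ|/2` — e.g.
for a FAITHFUL odd `χ` (`G ≅ μ_N` cyclic, `N = |G| = [K:ℚ]` with `t ≥ 2` prime factors): `m = 2^{t−2}` (codimension
`2` for `[K:ℚ] = 2pq` — the `(2,2)`-classes of the cyclic examples of Ribet and Hazama — and `4` for Lenstra's `2pqr`,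
cf. `DegenerateCMTypesLenstraThreePrimesField.exists_exceptional_codim_four`). -/

section LenstraCodimension

variable {Φ : CMType K}
variable {A : AbelianVariety ℂ} {ι : 𝓞 K →+* End A} {θ : K →+* Module.End ℂ (complexBetti A.X 1)}

omit [Normal ℚ K] in
/-- **White's set of an odd vanishing character has `2m` elements with `2m = 2^{ω(N)−1}·|ker χ|`.**
[cite: White1993SporadicCycles, §4 Lemma 3 and Theorem 3 (proofs)] -/
theorem card_whiteSet_eq_two_mul [IsCMField K] (hρ : ∀ x, φ₀ (ρ x) = starRingEnd ℂ (φ₀ x)) (Φ : CMType K)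
    (χ : AddChar (Additive (K ≃ₐ[ℚ] K)) ℂ) (hodd : χ (Additive.ofMul ρ) = -1)
    (hvan : ∑ g ∈ 𝓖[φ₀, Φ], χ (Additive.ofMul g) = 0) :
    (WhiteLenstra.whiteSet (Fintype.card (K ≃ₐ[ℚ] K)) χ).card =
      2 * (2 ^ ((Finset.univ.image fun g : K ≃ₐ[ℚ] K => χ (Additive.ofMul g)).card.primeFactors.card - 1) *
        (Finset.univ.filter fun g : K ≃ₐ[ℚ] K => χ (Additive.ofMul g) = 1).card / 2) := by
  have h := isCMTypeWith_galType hρ Φ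
  have heven := card_eq_two_mul_of_sporadic Φ (h.isBalanced_whiteSet hodd hvan)
  rw [← WhiteLenstra.card_whiteSet_card χ]
  omega

/-- **THE CODIMENSION OF LENSTRA'S CLASS.**  For `K` an abelian CM field, `Φ` PRIMITIVE, and an ODD character `χ` of
`Gal(K/ℚ)` (`χ(ρ) = −1`) VANISHING on `𝓖[φ₀, Φ]` (one exists iff `Φ` is degenerate, Kubota), EVERY abelian variety
of type `(K; Φ)` carries a rational `(m,m)`-class outside `Dᵐ(A) ⊗ ℂ` with
`m = 2^{ω(N)−1}·|ker χ|/2`, `N = |χ(Gal)| = [Gal : ker χ]` — White's "line" `Δ = {β = 1}` for `β = H·∏_{p|N}(1 − σ^{N/p})`,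
`|Δ| = 2^{ω(N)−1}|H|` (read off the proof; not printed as a formula).
[cite: White1993SporadicCycles, §1 (p. 124) and §4 Lemma 3, Theorem 3 (proofs)] [cite: Pohlmann1968, Thm. 1 and §3]
[cite: Kubota1965, §4 Lemma 2] -/
theorem exists_exceptional_of_oddCharacter [IsCMField K] (hρ : ∀ x, φ₀ (ρ x) = starRingEnd ℂ (φ₀ x))
    {φh : K →+* ℂ} (hprim : IsPrimitive (ℂ ≃+* ℂ) Φ.1 φh)
    (χ : AddChar (Additive (K ≃ₐ[ℚ] K)) ℂ) (hodd : χ (Additive.ofMul ρ) = -1)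
    (hvan : ∑ g ∈ 𝓖[φ₀, Φ], χ (Additive.ofMul g) = 0) (hA : IsCMTypeRealisation Φ A ι θ) :
    ∃ c : complexBetti A.X (2 * (2 ^ ((Finset.univ.image fun g : K ≃ₐ[ℚ] K => χ (Additive.ofMul g)).card.primeFactors.card
        - 1) * (Finset.univ.filter fun g : K ≃ₐ[ℚ] K => χ (Additive.ofMul g) = 1).card / 2)),
      IsRationalClass c ∧
      IsOfHodgeType (Module.finrank ℚ K / 2) A.X
        (2 * (2 ^ ((Finset.univ.image fun g : K ≃ₐ[ℚ] K => χ (Additive.ofMul g)).card.primeFactors.card - 1) *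
          (Finset.univ.filter fun g : K ≃ₐ[ℚ] K => χ (Additive.ofMul g) = 1).card / 2))
        (2 ^ ((Finset.univ.image fun g : K ≃ₐ[ℚ] K => χ (Additive.ofMul g)).card.primeFactors.card - 1) *
          (Finset.univ.filter fun g : K ≃ₐ[ℚ] K => χ (Additive.ofMul g) = 1).card / 2)
        (2 ^ ((Finset.univ.image fun g : K ≃ₐ[ℚ] K => χ (Additive.ofMul g)).card.primeFactors.card - 1) *
          (Finset.univ.filter fun g : K ≃ₐ[ℚ] K => χ (Additive.ofMul g) = 1).card / 2) c ∧
      c ∉ divisorClassesSpan A.X (Module.finrank ℚ K / 2)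
        (2 ^ ((Finset.univ.image fun g : K ≃ₐ[ℚ] K => χ (Additive.ofMul g)).card.primeFactors.card - 1) *
          (Finset.univ.filter fun g : K ≃ₐ[ℚ] K => χ (Additive.ofMul g) = 1).card / 2) := by
  have h := isCMTypeWith_galType hρ Φ
  exact exists_exceptional_of_sporadic_galType hρ hprim (h.isBalanced_whiteSet hodd hvan)
    (WhiteLenstra.one_mem_whiteSet _ χ) (fun _ hx => h.rho_mul_notMem_whiteSet hodd hx)
    (card_whiteSet_eq_two_mul hρ Φ χ hodd hvan) hA

/-- **Faithful characters**: if the odd vanishing `χ` is FAITHFUL (`ker χ = 1`, so `Gal(K/ℚ) ≅ μ_N` is cyclic of order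
`N = [K:ℚ]`), the class has codimension `m = 2^{ω([K:ℚ]) − 2}` when `[K:ℚ]` has `≥ 2` prime factors — `2` for
`[K:ℚ] = 2pq` (the `(2,2)`-classes of Ribet–Hazama's cyclic examples), `4` for Lenstra's `2pqr`
(`exists_exceptional_codim_four`). [cite: White1993SporadicCycles, §4 Lemma 3 and Theorem 3 (proofs)]
[cite: Pohlmann1968, Thm. 1 and §3] -/
theorem exists_exceptional_of_faithful_oddCharacter [IsCMField K] (hρ : ∀ x, φ₀ (ρ x) = starRingEnd ℂ (φ₀ x))
    {φh : K →+* ℂ} (hprim : IsPrimitive (ℂ ≃+* ℂ) Φ.1 φh)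
    (χ : AddChar (Additive (K ≃ₐ[ℚ] K)) ℂ) (hodd : χ (Additive.ofMul ρ) = -1)
    (hfaith : ∀ g : K ≃ₐ[ℚ] K, χ (Additive.ofMul g) = 1 → g = 1)
    (hvan : ∑ g ∈ 𝓖[φ₀, Φ], χ (Additive.ofMul g) = 0)
    (hω : 2 ≤ (Module.finrank ℚ K).primeFactors.card) (hA : IsCMTypeRealisation Φ A ι θ) :
    ∃ c : complexBetti A.X (2 * 2 ^ ((Module.finrank ℚ K).primeFactors.card - 2)), IsRationalClass c ∧
      IsOfHodgeType (Module.finrank ℚ K / 2) A.X (2 * 2 ^ ((Module.finrank ℚ K).primeFactors.card - 2))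
        (2 ^ ((Module.finrank ℚ K).primeFactors.card - 2)) (2 ^ ((Module.finrank ℚ K).primeFactors.card - 2)) c ∧
      c ∉ divisorClassesSpan A.X (Module.finrank ℚ K / 2) (2 ^ ((Module.finrank ℚ K).primeFactors.card - 2)) := by
  -- kernel = {1}, image has |Gal| = [K:ℚ] elements
  have hker : (Finset.univ.filter fun g : K ≃ₐ[ℚ] K => χ (Additive.ofMul g) = 1) = {1} := by
    ext g
    simp only [Finset.mem_filter, Finset.mem_univ, true_and, Finset.mem_singleton]
    exact ⟨hfaith g, fun hg => by rw [hg, ofMul_one, AddChar.map_zero_eq_one]⟩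
  have hinj : Function.Injective fun g : K ≃ₐ[ℚ] K => χ (Additive.ofMul g) := by
    intro g g' hgg'
    -- `χ(g') ≠ 0` (a root of unity) and `χ(g')·χ(g'⁻¹g) = χ(g) = χ(g')`, so `χ(g'⁻¹g) = 1`, `g'⁻¹g = 1`
    have hne : χ (Additive.ofMul g') ≠ 0 := fun h0 => by
      have hpow : χ (Additive.ofMul g') ^ Fintype.card (K ≃ₐ[ℚ] K) = 1 := by
        rw [← AddChar.map_nsmul_eq_pow, ← ofMul_pow, pow_card_eq_one, ofMul_one, AddChar.map_zero_eq_one]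
      rw [h0, zero_pow Fintype.card_ne_zero] at hpow
      exact zero_ne_one hpow
    have hmul : χ (Additive.ofMul g') * χ (Additive.ofMul (g'⁻¹ * g)) = χ (Additive.ofMul g') * 1 := by
      rw [← AddChar.map_add_eq_mul, ← ofMul_mul, mul_inv_cancel_left, mul_one]
      exact hgg'
    have h1 : g'⁻¹ * g = 1 := hfaith _ ((mul_right_inj' hne).1 hmul)
    exact ((inv_mul_eq_one.1 h1)).symm
  have himg : (Finset.univ.image fun g : K ≃ₐ[ℚ] K => χ (Additive.ofMul g)).card = Module.finrank ℚ K := by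
    rw [Finset.card_image_of_injective _ hinj, Finset.card_univ, card_gal_eq_finrank φ₀]
  have hm : 2 ^ ((Finset.univ.image fun g : K ≃ₐ[ℚ] K => χ (Additive.ofMul g)).card.primeFactors.card - 1) *
      (Finset.univ.filter fun g : K ≃ₐ[ℚ] K => χ (Additive.ofMul g) = 1).card / 2 =
        2 ^ ((Module.finrank ℚ K).primeFactors.card - 2) := by
    rw [himg, hker, Finset.card_singleton, mul_one]
    obtain ⟨k, hk⟩ := Nat.exists_eq_add_of_le hω
    rw [hk, show 2 + k - 1 = k + 1 by omega, show 2 + k - 2 = k by omega, pow_succ, Nat.mul_div_cancel _ two_pos]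
  have := exists_exceptional_of_oddCharacter hρ hprim χ hodd hvan hA
  rwa [hm] at this

end LenstraCodimension

end AbelianCMField

end Literature.AlgebraicGeometry.Pohlmann1968

end
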